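import Mathlib
import HarnessLib
import Literature.Analysis.Complex.CoincidenceLemma
import Summits.Parity.BatemanHorn.Theses.AlmostPrimeZeros
import Summits.Parity.BatemanHorn.Theorems.AlmostPrimeZerosDeficitFromRepulsion
import Summits.Parity.BatemanHorn.Theorems.AlmostPrimeZerosSystemMomentDeficitZeroFree
import Summits.Parity.BatemanHorn.Theorems.AlmostPrimeZerosSystemMomentDeficitPoissonJensenBound
import Summits.Parity.BatemanHorn.Theorems.AlmostPrimeZerosSystemMomentDeficitLogDerivBound
import Summits.Parity.BatemanHorn.Theorems.AlmostPrimeZerosSystemMomentDeficitLogDerivPolynomial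
import Summits.Parity.BatemanHorn.Theorems.AlmostPrimeZerosSystemMomentDeficitSmallCircleOfDiscMajorantLog

/-!
# Crux `SystemMomentDeficit` (stmt-Parity-11326): the deficit from a small-circle mean, and the
# route edge `DiscMajorantLog → SystemMomentDeficit`

Route `AlmostPrimeZeros`, crux
`Summit.Parity.BatemanHorn.Theses.AlmostPrimeZeros.SystemMomentDeficit` (rank 4): for every
Bateman–Horn system `f`, the factorial-moment deficit `m₁(x) − v(x)` of the capped statistic
`s_f(n) = Σ_i Σ_{p^v ∥ f_i(n)} min(v, 2)` is bounded above for `x ≥ 2`.  Line `Sketch` (idea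
`small-circle-jensen`), lead a1.  Everything in this file is sorry-free; it composes the four landed
complex-analysis stubs of the line (`stub_zeroFree` p140102, `stub_poissonJensenBound` p140189,
`stub_logDerivBound` p140086, `stub_logDerivPolynomial` p140125) and the bookkeeping stub
`stub_smallCircle_of_discMajorantLog` (p140287).

Let `P = Σ_{0 ≤ n ≤ x} X^{e n} ∈ ℂ[X]` for an exponent sequence `e` (the almost-prime polynomial when
`e = s_f`; `P(z) = S_x(z)`, `P(1) = x + 1`) and, for a real tilt `a`, `H(z) = P(z) e^{−a(z−1)} / P(1)`
(entire, `H(1) = 1`).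

* `jensenPoissonDeficit` — the Jensen–Poisson deficit lemma (P1 of the card): for any `P ∈ ℂ[X]`
  with `P(1) ≠ 0`, `r > 0`, `A ≥ 0`: `⨍_{‖z−1‖=r} log⁺‖H‖ ≤ A ⟹ ‖P''(1)/P(1) − (P'(1)/P(1))²‖ ≤
  256(3A+1)e^{2A}/r²` (Jensen ⇒ zero-free disc `r e^{−A}`; Poisson–Jensen ⇒ `‖H‖ ≤ e^{3A}` on
  `‖z−1‖ ≤ r/2`; holomorphic log + Borel–Carathéodory + Cauchy on the disc of radius `r e^{−A}/2`;
  the tilt is log-linear).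
* `deficit_le_norm` — `m₁ − v = Re[(P'(1)/P(1))² − P''(1)/P(1)] ≤ ‖P''(1)/P(1) − (P'(1)/P(1))²‖`
  (tree identity `Summit.Parity.BatemanHorn.Theorems.sum_inv_one_sub_sq_roots_eq`).
* `deficit_le_of_circleAverage` — per statistic: a circle-mean bound `A` at radius `r` (any tilt)
  gives `m₁ − v ≤ 256(3A+1)e^{2A}/r²`.
* `systemMomentDeficit_of_smallCircle` — the crux (unfolded) from K1 = `SmallCircleJensen`
  (for every system `∃ r A x₀ ∀ x ≥ x₀ ∃ a`, circle mean `≤ A`), absorbing the finitely many `x < x₀`.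
* `systemMomentDeficit_of_discMajorantLog : DiscMajorantLog → SystemMomentDeficit` — the NEW ROUTE
  EDGE rank 8 ⇒ rank 4 (previously rank 8 reached rank 4 only together with rank 7 `FarMomentWide`
  through `RepulsionFromNearFar` and `DeficitFromRepulsion`): the parity-blind crux is the
  `‖z−1‖ ≤ 1`, angular-L¹ fragment of the rank-8 disc majorant.

What remains open on the line is K1 itself (registered stub `stub_smallCircleJensen`, skeleton
`Cruxes/SystemMomentDeficit/Lines/Sketch.lean`): an angular-L¹ bound for `log⁺‖S_x e^{−a(z−1)}/(x+1)‖`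
on one fixed circle, uniformly in `x` — open for every system with `Σ deg f_i ≥ 2`.

References: idea card `Cruxes/SystemMomentDeficit/Ideas/small-circle-jensen.md`; E. C. Titchmarsh,
*The Theory of Functions*, 2nd ed., §3.61 (Jensen), §3.62 (Poisson–Jensen), §5.5 (Borel–Carathéodory);
G. Tenenbaum, *Introduction to analytic and probabilistic number theory*, II.5–II.6 (the LSD majorant
this packages).
-/

noncomputable section

namespace Summit.Parity.BatemanHorn.Cruxes.SystemMomentDeficit.SmallCircle

open scoped BigOperators Nat
open Polynomial
open Summit.Parity.BatemanHorn.Theses.AlmostPrimeZeros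

/-! ### Composition (sorry-free) -/

/-- **The Jensen–Poisson deficit lemma** (P1 of the card, composed from the four analysis stubs):
if `⨍_{‖z−1‖=r} log⁺‖P(z)e^{−a(z−1)}/P(1)‖ ≤ A` then
`‖P''(1)/P(1) − (P'(1)/P(1))²‖ ≤ 256(3A+1)e^{2A}/r²`. -/
theorem jensenPoissonDeficit (P : Polynomial ℂ) (r a A : ℝ) (hr : 0 < r) (hA : 0 ≤ A)
    (hP1 : P.eval 1 ≠ 0)
    (hJ : Real.circleAverage (fun z : ℂ => Real.posLog
      ‖P.eval z * Complex.exp (-((a : ℂ) * (z - 1))) / P.eval 1‖) 1 r ≤ A) :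
    ‖(derivative (derivative P)).eval 1 / P.eval 1 - ((derivative P).eval 1 / P.eval 1) ^ 2‖ ≤
      256 * (3 * A + 1) * Real.exp (2 * A) / r ^ 2 := by
  set F : ℂ → ℂ := fun z : ℂ => P.eval z * Complex.exp (-((a : ℂ) * (z - 1))) / P.eval 1 with hF
  have hzero := stub_zeroFree P r a A hr hA hP1 hJ
  have hbound := stub_poissonJensenBound P r a A hr hA hP1 hJ
  set R : ℝ := r * Real.exp (-A) / 2 with hR
  have hexp1 : Real.exp (-A) ≤ 1 := by
    rw [Real.exp_le_one_iff]; linarith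
  have hexp0 : 0 < Real.exp (-A) := Real.exp_pos _
  have hR0 : 0 < R := by rw [hR]; positivity
  have hRle1 : R ≤ r * Real.exp (-A) := by
    rw [hR]; nlinarith [mul_pos hr hexp0]
  have hRle2 : R ≤ r / 2 := by
    rw [hR]
    have : r * Real.exp (-A) ≤ r * 1 := mul_le_mul_of_nonneg_left hexp1 hr.le
    linarith
  have hdiff : DifferentiableOn ℂ F (Metric.ball 1 R) := by
    apply Differentiable.differentiableOn
    rw [hF]
    exact ((P.differentiable).mul (by fun_prop)).div_const _
  have hne : ∀ z ∈ Metric.ball (1 : ℂ) R, F z ≠ 0 := by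
    intro z hz
    rw [Metric.mem_ball, dist_eq_norm] at hz
    have hPz : P.eval z ≠ 0 := hzero z (lt_of_lt_of_le hz hRle1)
    rw [hF]
    exact div_ne_zero (mul_ne_zero hPz (Complex.exp_ne_zero _)) hP1
  have hF1 : F 1 = 1 := by
    rw [hF]
    simp [hP1]
  have hFbd : ∀ z ∈ Metric.ball (1 : ℂ) R, ‖F z‖ ≤ Real.exp (3 * A) := by
    intro z hz
    rw [Metric.mem_ball, dist_eq_norm] at hz
    exact hbound z (le_trans hz.le hRle2)
  have h3A : 0 ≤ 3 * A := by positivity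
  have key := stub_logDerivBound F R (3 * A) hR0 h3A hdiff hne hF1 hFbd
  rw [hF, stub_logDerivPolynomial P a hP1] at key
  refine key.trans (le_of_eq ?_)
  rw [hR, Real.exp_neg]
  have hE : Real.exp A ≠ 0 := (Real.exp_pos A).ne'
  have hE2 : Real.exp (2 * A) = Real.exp A ^ 2 := by
    rw [← Real.exp_nat_mul]; norm_num
  rw [hE2]
  field_simp
  ring

/-- A real sequence bounded above from some point on is bounded above everywhere (the finitely
many earlier values are absorbed into the constant). -/
theorem bddAbove_of_eventually {T : ℕ → ℝ} {B : ℝ} {x₀ : ℕ} (h : ∀ x, x₀ ≤ x → T x ≤ B) :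
    ∃ C : ℝ, ∀ x, T x ≤ C := by
  refine ⟨|B| + ∑ x ∈ Finset.range x₀, |T x|, fun x => ?_⟩
  have hS : 0 ≤ ∑ x ∈ Finset.range x₀, |T x| := Finset.sum_nonneg fun x _ => abs_nonneg _
  by_cases hx : x₀ ≤ x
  · exact (h x hx).trans ((le_abs_self B).trans (le_add_of_nonneg_right hS))
  · have hx' : x ∈ Finset.range x₀ := Finset.mem_range.2 (lt_of_not_ge hx)
    calc T x ≤ |T x| := le_abs_self _
      _ ≤ ∑ x ∈ Finset.range x₀, |T x| := Finset.single_le_sum (fun x _ => abs_nonneg (T x)) hx'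
      _ ≤ |B| + ∑ x ∈ Finset.range x₀, |T x| := le_add_of_nonneg_left (abs_nonneg B)

/-- **The deficit is a second Taylor datum of `log P` at `1`.**  For an exponent sequence `e` and
`P = Σ_{n ≤ x} X^{e n}`: `m₁ − v = Re[(P'(1)/P(1))² − P''(1)/P(1)] ≤ ‖P''(1)/P(1) − (P'(1)/P(1))²‖`
(tree identity `sum_inv_one_sub_sq_roots_eq` and the logarithmic derivatives of a split polynomial). -/
theorem deficit_le_norm (e : ℕ → ℕ) (x : ℕ) :
    ((∑ n ∈ Finset.range (x + 1), e n : ℕ) : ℝ) / ((x : ℝ) + 1) -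
      ((((∑ n ∈ Finset.range (x + 1), (e n) ^ 2 : ℕ)) : ℝ) / ((x : ℝ) + 1) -
        (((∑ n ∈ Finset.range (x + 1), e n : ℕ) : ℝ) / ((x : ℝ) + 1)) ^ 2) ≤
    ‖(derivative (derivative (∑ n ∈ Finset.range (x + 1), (X : ℂ[X]) ^ (e n)))).eval 1 /
        (∑ n ∈ Finset.range (x + 1), (X : ℂ[X]) ^ (e n)).eval 1 -
      ((derivative (∑ n ∈ Finset.range (x + 1), (X : ℂ[X]) ^ (e n))).eval 1 /
        (∑ n ∈ Finset.range (x + 1), (X : ℂ[X]) ^ (e n)).eval 1) ^ 2‖ := by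
  set P : ℂ[X] := ∑ n ∈ Finset.range (x + 1), (X : ℂ[X]) ^ (e n) with hP
  have hN : ((x : ℂ) + 1) ≠ 0 := by exact_mod_cast Nat.succ_ne_zero x
  have hP1 : P.eval 1 ≠ 0 := by
    rw [hP, Summit.Parity.BatemanHorn.Theorems.eval_one_sum_X_pow]; exact hN
  have h2 := Literature.Analysis.Complex.PolyaSchur.eval_derivative_derivative_div_eval hP1
  have h1 : P.derivative.eval 1 / P.eval 1 = (P.roots.map fun a => ((1 : ℂ) - a)⁻¹).sum := by
    rw [(IsAlgClosed.splits P).eval_derivative_div_eval_of_ne_zero hP1]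
    simp only [one_div]
  have hS2 : (P.roots.map fun ρ : ℂ => (((1 : ℂ) - ρ) ^ 2)⁻¹).sum =
      (P.derivative.eval 1 / P.eval 1) ^ 2 - P.derivative.derivative.eval 1 / P.eval 1 := by
    rw [h2, h1]; ring
  have key := Summit.Parity.BatemanHorn.Theorems.sum_inv_one_sub_sq_roots_eq e x
  rw [← hP] at key
  rw [hS2] at key
  have hre := congrArg Complex.re key
  rw [Complex.ofReal_re] at hre
  rw [← hre]
  calc ((P.derivative.eval 1 / P.eval 1) ^ 2 - P.derivative.derivative.eval 1 / P.eval 1).re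
      ≤ ‖(P.derivative.eval 1 / P.eval 1) ^ 2 - P.derivative.derivative.eval 1 / P.eval 1‖ :=
        Complex.re_le_norm _
    _ = ‖P.derivative.derivative.eval 1 / P.eval 1 - (P.derivative.eval 1 / P.eval 1) ^ 2‖ :=
        norm_sub_rev _ _

/-- **Two-sided form of the identity.**  `|m₁ − v| ≤ ‖P''(1)/P(1) − (P'(1)/P(1))²‖` for
`P = Σ_{n ≤ x} X^{e n}` (`|Re w| ≤ ‖w‖`). -/
theorem abs_deficit_le_norm (e : ℕ → ℕ) (x : ℕ) :
    |((∑ n ∈ Finset.range (x + 1), e n : ℕ) : ℝ) / ((x : ℝ) + 1) -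
      ((((∑ n ∈ Finset.range (x + 1), (e n) ^ 2 : ℕ)) : ℝ) / ((x : ℝ) + 1) -
        (((∑ n ∈ Finset.range (x + 1), e n : ℕ) : ℝ) / ((x : ℝ) + 1)) ^ 2)| ≤
    ‖(derivative (derivative (∑ n ∈ Finset.range (x + 1), (X : ℂ[X]) ^ (e n)))).eval 1 /
        (∑ n ∈ Finset.range (x + 1), (X : ℂ[X]) ^ (e n)).eval 1 -
      ((derivative (∑ n ∈ Finset.range (x + 1), (X : ℂ[X]) ^ (e n))).eval 1 /
        (∑ n ∈ Finset.range (x + 1), (X : ℂ[X]) ^ (e n)).eval 1) ^ 2‖ := by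
  set P : ℂ[X] := ∑ n ∈ Finset.range (x + 1), (X : ℂ[X]) ^ (e n) with hP
  have hN : ((x : ℂ) + 1) ≠ 0 := by exact_mod_cast Nat.succ_ne_zero x
  have hP1 : P.eval 1 ≠ 0 := by
    rw [hP, Summit.Parity.BatemanHorn.Theorems.eval_one_sum_X_pow]; exact hN
  have h2 := Literature.Analysis.Complex.PolyaSchur.eval_derivative_derivative_div_eval hP1
  have h1 : P.derivative.eval 1 / P.eval 1 = (P.roots.map fun a => ((1 : ℂ) - a)⁻¹).sum := by
    rw [(IsAlgClosed.splits P).eval_derivative_div_eval_of_ne_zero hP1]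
    simp only [one_div]
  have hS2 : (P.roots.map fun ρ : ℂ => (((1 : ℂ) - ρ) ^ 2)⁻¹).sum =
      (P.derivative.eval 1 / P.eval 1) ^ 2 - P.derivative.derivative.eval 1 / P.eval 1 := by
    rw [h2, h1]; ring
  have key := Summit.Parity.BatemanHorn.Theorems.sum_inv_one_sub_sq_roots_eq e x
  rw [← hP] at key
  rw [hS2] at key
  have hre := congrArg Complex.re key
  rw [Complex.ofReal_re] at hre
  rw [← hre]
  calc |((P.derivative.eval 1 / P.eval 1) ^ 2 - P.derivative.derivative.eval 1 / P.eval 1).re|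
      ≤ ‖(P.derivative.eval 1 / P.eval 1) ^ 2 - P.derivative.derivative.eval 1 / P.eval 1‖ :=
        Complex.abs_re_le_norm _
    _ = ‖P.derivative.derivative.eval 1 / P.eval 1 - (P.derivative.eval 1 / P.eval 1) ^ 2‖ :=
        norm_sub_rev _ _

/-- **Two-sided deficit bound from a small-circle mean, per statistic**: under the hypothesis of
`deficit_le_of_circleAverage`, `|m₁ − v| ≤ 256(3A+1)e^{2A}/r²` — the transfer of the line is
two-sided (it bounds `v − m₁` as well). -/
theorem abs_deficit_le_of_circleAverage (e : ℕ → ℕ) (x : ℕ) (r a A : ℝ) (hr : 0 < r) (hA : 0 ≤ A)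
    (hJ : Real.circleAverage (fun z : ℂ => Real.posLog
      ‖(∑ n ∈ Finset.range (x + 1), z ^ (e n)) * Complex.exp (-((a : ℂ) * (z - 1))) /
        ((x : ℂ) + 1)‖) 1 r ≤ A) :
    |((∑ n ∈ Finset.range (x + 1), e n : ℕ) : ℝ) / ((x : ℝ) + 1) -
      ((((∑ n ∈ Finset.range (x + 1), (e n) ^ 2 : ℕ)) : ℝ) / ((x : ℝ) + 1) -
        (((∑ n ∈ Finset.range (x + 1), e n : ℕ) : ℝ) / ((x : ℝ) + 1)) ^ 2)| ≤
    256 * (3 * A + 1) * Real.exp (2 * A) / r ^ 2 := by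
  set P : ℂ[X] := ∑ n ∈ Finset.range (x + 1), (X : ℂ[X]) ^ (e n) with hP
  have heval : ∀ z : ℂ, P.eval z = ∑ n ∈ Finset.range (x + 1), z ^ (e n) := by
    intro z
    simp [hP, Polynomial.eval_finsetSum]
  have hP1 : P.eval 1 = (x : ℂ) + 1 := by
    rw [heval]; simp
  have hN : ((x : ℂ) + 1) ≠ 0 := by exact_mod_cast Nat.succ_ne_zero x
  have hP1ne : P.eval 1 ≠ 0 := by rw [hP1]; exact hN
  have hJ' : Real.circleAverage (fun z : ℂ => Real.posLog
      ‖P.eval z * Complex.exp (-((a : ℂ) * (z - 1))) / P.eval 1‖) 1 r ≤ A := by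
    have hfun : (fun z : ℂ => Real.posLog
        ‖P.eval z * Complex.exp (-((a : ℂ) * (z - 1))) / P.eval 1‖) =
        (fun z : ℂ => Real.posLog
          ‖(∑ n ∈ Finset.range (x + 1), z ^ (e n)) * Complex.exp (-((a : ℂ) * (z - 1))) /
            ((x : ℂ) + 1)‖) := by
      funext z
      rw [heval, hP1]
    rw [hfun]
    exact hJ
  exact (abs_deficit_le_norm e x).trans (jensenPoissonDeficit P r a A hr hA hP1ne hJ')

/-- **The deficit from a small-circle mean, per statistic.**  For an exponent sequence `e`, `x`,
a radius `r > 0`, a tilt `a` and `A ≥ 0`: if `⨍_{‖z−1‖=r} log⁺‖S(z)e^{−a(z−1)}/(x+1)‖ ≤ A` for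
`S(z) = Σ_{n ≤ x} z^{e n}`, then `m₁ − v ≤ 256(3A+1)e^{2A}/r²`. -/
theorem deficit_le_of_circleAverage (e : ℕ → ℕ) (x : ℕ) (r a A : ℝ) (hr : 0 < r) (hA : 0 ≤ A)
    (hJ : Real.circleAverage (fun z : ℂ => Real.posLog
      ‖(∑ n ∈ Finset.range (x + 1), z ^ (e n)) * Complex.exp (-((a : ℂ) * (z - 1))) /
        ((x : ℂ) + 1)‖) 1 r ≤ A) :
    ((∑ n ∈ Finset.range (x + 1), e n : ℕ) : ℝ) / ((x : ℝ) + 1) -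
      ((((∑ n ∈ Finset.range (x + 1), (e n) ^ 2 : ℕ)) : ℝ) / ((x : ℝ) + 1) -
        (((∑ n ∈ Finset.range (x + 1), e n : ℕ) : ℝ) / ((x : ℝ) + 1)) ^ 2) ≤
    256 * (3 * A + 1) * Real.exp (2 * A) / r ^ 2 := by
  set P : ℂ[X] := ∑ n ∈ Finset.range (x + 1), (X : ℂ[X]) ^ (e n) with hP
  have heval : ∀ z : ℂ, P.eval z = ∑ n ∈ Finset.range (x + 1), z ^ (e n) := by
    intro z
    simp [hP, Polynomial.eval_finsetSum]
  have hP1 : P.eval 1 = (x : ℂ) + 1 := by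
    rw [heval]; simp
  have hN : ((x : ℂ) + 1) ≠ 0 := by exact_mod_cast Nat.succ_ne_zero x
  have hP1ne : P.eval 1 ≠ 0 := by rw [hP1]; exact hN
  have hJ' : Real.circleAverage (fun z : ℂ => Real.posLog
      ‖P.eval z * Complex.exp (-((a : ℂ) * (z - 1))) / P.eval 1‖) 1 r ≤ A := by
    have hfun : (fun z : ℂ => Real.posLog
        ‖P.eval z * Complex.exp (-((a : ℂ) * (z - 1))) / P.eval 1‖) =
        (fun z : ℂ => Real.posLog
          ‖(∑ n ∈ Finset.range (x + 1), z ^ (e n)) * Complex.exp (-((a : ℂ) * (z - 1))) /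
            ((x : ℂ) + 1)‖) := by
      funext z
      rw [heval, hP1]
    rw [hfun]
    exact hJ
  exact (deficit_le_norm e x).trans (jensenPoissonDeficit P r a A hr hA hP1ne hJ')

/-- **The crux from K1** (composition of the line, generic in the source of K1; the conclusion is
`SystemMomentDeficit` unfolded, so that the skeleton's deciding theorem is `SystemMomentDeficit_of`). -/
theorem systemMomentDeficit_of_smallCircle
    (hK1 : ∀ (k : ℕ) (f : Fin k → Polynomial ℤ), Literature.NumberTheory.Sieve.IsBatemanHornSystem f →
      ∃ r A : ℝ, ∃ x₀ : ℕ, 0 < r ∧ 0 ≤ A ∧ ∀ x : ℕ, x₀ ≤ x → ∃ a : ℝ,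
        Real.circleAverage (fun z : ℂ => Real.posLog
          ‖(∑ n ∈ Finset.range (x + 1),
              z ^ (∑ i, (((f i).eval (n : ℤ)).toNat.factorization.sum fun _ v => min v 2))) *
            Complex.exp (-((a : ℂ) * (z - 1))) / ((x : ℂ) + 1)‖) 1 r ≤ A) :
    ∀ (k : ℕ) (f : Fin k → Polynomial ℤ), Literature.NumberTheory.Sieve.IsBatemanHornSystem f →
      ∃ C : ℝ, ∀ x : ℕ, 2 ≤ x →
        ((∑ n ∈ Finset.range (x + 1), ∑ i, (((f i).eval (n : ℤ)).toNat.factorization.sum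
            fun _ v => min v 2) : ℕ) : ℝ) / ((x : ℝ) + 1) -
          (((∑ n ∈ Finset.range (x + 1), (∑ i, (((f i).eval (n : ℤ)).toNat.factorization.sum
              fun _ v => min v 2)) ^ 2 : ℕ) : ℝ) / ((x : ℝ) + 1) -
            (((∑ n ∈ Finset.range (x + 1), ∑ i, (((f i).eval (n : ℤ)).toNat.factorization.sum
              fun _ v => min v 2) : ℕ) : ℝ) / ((x : ℝ) + 1)) ^ 2) ≤ C := by
  intro k f hf
  obtain ⟨r, A, x₀, hr, hA, hJ⟩ := hK1 k f hf
  set e : ℕ → ℕ := fun n => ∑ i, (((f i).eval (n : ℤ)).toNat.factorization.sum fun _ v => min v 2)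
    with he
  obtain ⟨C, hC⟩ := bddAbove_of_eventually (x₀ := x₀)
    (T := fun x : ℕ => ((∑ n ∈ Finset.range (x + 1), e n : ℕ) : ℝ) / ((x : ℝ) + 1) -
      ((((∑ n ∈ Finset.range (x + 1), (e n) ^ 2 : ℕ)) : ℝ) / ((x : ℝ) + 1) -
        (((∑ n ∈ Finset.range (x + 1), e n : ℕ) : ℝ) / ((x : ℝ) + 1)) ^ 2))
    (B := 256 * (3 * A + 1) * Real.exp (2 * A) / r ^ 2)
    (fun x hx => by
      obtain ⟨a, ha⟩ := hJ x hx
      exact deficit_le_of_circleAverage e x r a A hr hA ha)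
  exact ⟨C, fun x _ => hC x⟩

/-- **New route edge `DiscMajorantLog → SystemMomentDeficit`** (rank 8 ⇒ rank 4 directly, without
`FarMomentWide`): the rank-8 disc majorant restricted to the circle `‖z − 1‖ = 1` is K1. -/
theorem systemMomentDeficit_of_discMajorantLog :
    Summit.Parity.BatemanHorn.Theses.AlmostPrimeZeros.DiscMajorantLog →
      Summit.Parity.BatemanHorn.Theses.AlmostPrimeZeros.SystemMomentDeficit := by
  intro hD
  unfold SystemMomentDeficit
  exact systemMomentDeficit_of_smallCircle (stub_smallCircle_of_discMajorantLog hD)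

end Summit.Parity.BatemanHorn.Cruxes.SystemMomentDeficit.SmallCircle

end
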